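import Summits.BirchSwinnertonDyer.BirchSwinnertonDyer.Theses.ErratumRoadFive
import Summits.BirchSwinnertonDyer.BirchSwinnertonDyer.Theorems.ErratumRoadFiveRest3ShaBranchesDefs
import Summits.BirchSwinnertonDyer.Rank1Residual.X11b.BDPRouteEndState
import HarnessLib

/-!
# Route `ErratumRoadFive` (rung K2, `p ≥ 5`), crux `RamNoErratumDataAtFive` (item stmt-BirchSwinnertonDyer-19624, REST‴) BY NAME versus
# its `Ш_an`-cut (`ErratumRoadFiveRest3ShaBranchesDefs.lean`): the crux ⟺ its residual branch (D) modulo the route's support items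
# (cell `bsd-stepL`, owner seat `bsd-stepL-rest-p2` g4; `--supports stmt-BirchSwinnertonDyer-19624`; THEOREMS ONLY — no definition,
# no named fact, no `sorry`)

HONEST FRAMING. Packaging over `PublishedInputsFive` (19066) and `JSWAnticyclotomicControlMult` (19626): branch (U)
`Rest3ShaUnitBranchAtFive` is a theorem modulo these two items, so `RamNoErratumDataAtFive` ⟺ `Rest3ShaDivisibleBranchAtFive` (D) — the
crux's whole open content is the lower half of `BSD(E,p)` at the (ram) no-erratum pairs with `p ∣ #Ш(E)_an` (EMPTY below `5·10⁵`;
BSD-predicted = `Ш(E)[p] ≠ 0`; no road in print). CONDITIONAL on the two support items; BSD is proved for no pair; nothing booked (T7).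

References: [Miller2011LMS] Def. 1.1; [JetchevSkinnerWan2017] Thm. 3.3.1, §7.4.1; [Skinner2016PacificMC] Thm. C; [Castella2018Erratum]
Thm. 1.1 (iii)–(iv); [Wuthrich2014] Prop. 21.
-/

-- the Theorems namespace of this sub repeats the summit name by design (D-0017 nested layout)
set_option linter.dupNamespace false
set_option autoImplicit false

noncomputable section

open scoped Classical

namespace Summit.BirchSwinnertonDyer.BirchSwinnertonDyer.Theorems

open WeierstrassCurve NumberField Literature.NumberTheory.EllipticCurves
  Literature.NumberTheory.EllipticCurves.Rank1Residual
  Literature.NumberTheory.EllipticCurves.Rank1Residual.Typed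
  Summit.BirchSwinnertonDyer.Rank1Residual Summit.BirchSwinnertonDyer.Rank1Residual.X11b
  Summit.BirchSwinnertonDyer.BirchSwinnertonDyer.Theses.ErratumRoadFive

/-- **Branch (U) by the route's names**: `PublishedInputsFive` + `JSWAnticyclotomicControlMult` ⟹ `Rest3ShaUnitBranchAtFive`. CONDITIONAL
on the two support items only; nothing booked. [cite: JetchevSkinnerWan2017, Thm. 3.3.1, §7.4.1] [cite: Skinner2016PacificMC, Thm. C (§1)] -/
theorem rest3ShaUnitBranchAtFive_of_publishedInputsFive
    (hF : PublishedInputsFive) (h331 : JSWAnticyclotomicControlMult) : Rest3ShaUnitBranchAtFive := by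
  obtain ⟨hGZ, hKo, -, hSk, -, hGZK, hmod, -, -, -, -, -, -, -, -⟩ := hF
  exact rest3ShaUnitBranchAtFive_of_thm331Mult h331 hGZ hKo hSk hGZK hmod

/-- **The crux BY NAME ⟸ branch (D) + the two support items** (the DOWN form). CONDITIONAL; nothing booked.
[cite: Castella2018Erratum, Thm. 1.1 (iii)–(iv)] [cite: JetchevSkinnerWan2017, Thm. 3.3.1, §7.4.1] -/
theorem ramNoErratumDataAtFive_of_publishedInputsFive_of_rest3ShaDivisibleBranch
    (hF : PublishedInputsFive) (h331 : JSWAnticyclotomicControlMult) (hD : Rest3ShaDivisibleBranchAtFive) :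
    RamNoErratumDataAtFive :=
  rest3_of_shaBranches (rest3ShaUnitBranchAtFive_of_publishedInputsFive hF h331) hD

/-- The crux ⟹ branch (D) (by name; drop the valuation clause). Bookkeeping. [folklore] -/
theorem rest3ShaDivisibleBranchAtFive_of_ramNoErratumDataAtFive (hR : RamNoErratumDataAtFive) :
    Rest3ShaDivisibleBranchAtFive :=
  rest3ShaDivisibleBranchAtFive_of_rest3 hR

/-- **Item 19624 ⟺ its residual branch (D)**, modulo `PublishedInputsFive` + `JSWAnticyclotomicControlMult`: the crux's whole open
content is `Rest3ShaDivisibleBranchAtFive` — the lower half of `BSD(E,p)` at the (ram) no-erratum pairs with `p ∣ #Ш(E)_an` (EMPTY below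
`5·10⁵`). CONDITIONAL; nothing booked. [cite: Miller2011LMS, Def. 1.1] [cite: Castella2018Erratum, Thm. 1.1 (iii)–(iv)] -/
theorem ramNoErratumDataAtFive_iff_rest3ShaDivisibleBranch
    (hF : PublishedInputsFive) (h331 : JSWAnticyclotomicControlMult) :
    RamNoErratumDataAtFive ↔ Rest3ShaDivisibleBranchAtFive :=
  ⟨rest3ShaDivisibleBranchAtFive_of_ramNoErratumDataAtFive,
    ramNoErratumDataAtFive_of_publishedInputsFive_of_rest3ShaDivisibleBranch hF h331⟩

/-- **Branch (D) ⟺ the lower half `Typed.MissingLowerBoundAt` at the D-pairs** (X11b, `p ≥ 5`, `ρ̄` onto, (ram), no erratum datum,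
positive valuation of every rational value of `#Ш(E)_an`), modulo the two support items — exactness restricted to the residual (⟹: multr1-p2's `P2.missingLowerBoundAt_of_openInputAt`; ⟸: imc-p1's one-sided tightness).
CONDITIONAL; nothing booked. [cite: Wuthrich2014, Prop. 21 (p. 400)] [cite: JetchevSkinnerWan2017, Thm. 3.3.1, §7.4.1] [cite: Miller2011LMS, Def. 1.1] -/
theorem rest3ShaDivisibleBranchAtFive_iff_missingLowerBound_onD
    (hF : PublishedInputsFive) (h331 : JSWAnticyclotomicControlMult) :
    Rest3ShaDivisibleBranchAtFive ↔
      ∀ (W : WeierstrassCurve ℚ) [W.IsElliptic] [W.IsGloballyMinimal] (p : ℕ) [Fact p.Prime],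
        ClassX11b W p → 5 ≤ p → Rank1Residual.Surj W p → Rank1Residual.Ram W p →
        ¬ ((∃ (q : ℕ) (_ : Fact q.Prime), q ≠ 2 ∧ q ≠ p ∧ Rank1Residual.Mult W q ∧
            ¬ W.HasSplitMultiplicativeReductionAtPrime q ∧ ¬ p ∣ padicValInt q W.minimalDiscriminantInt) ∧
          (∀ P : (W.baseChange ℚ_[p]).toAffine.Point, p • P = 0 → P = 0)) →
        (∀ s : ℚ, shaAn W = (s : ℂ) → 0 < padicValRat p s) → Typed.MissingLowerBoundAt W p := by
  obtain ⟨hGZ, hKo, -, hSk, hWu, hGZK, hmod, hnf, hHL, -, hMaz, -, -, hPT, hEP⟩ := hF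
  constructor
  · intro hD W _ _ p _ hX hp5 hsurj hram hno hpos
    exact P2.missingLowerBoundAt_of_openInputAt W p hGZ hKo hWu hGZK hmod hnf hHL hMaz hPT hEP (hD W p hram hno hpos) hX hp5
      hsurj
  · intro hlow
    refine rest3ShaDivisibleBranchAtFive_of_sharp fun W _ _ p _ hX hp5 hsj hram hno hpos ↦ ?_
    exact openInputOnTreeAt_of_missingLowerBoundAt_of_ram_of_thm331Mult W p h331 hGZ hKo hSk hGZK hmod hram
      (hlow W p hX hp5 hsj hram hno hpos)

end Summit.BirchSwinnertonDyer.BirchSwinnertonDyer.Theorems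

end
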